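import Literature.Algebra.EuclideanLattices.RegevBoxGaussianState
import HarnessLib

/-!
# Regev 2009, Lemma 3.14 (machine form), IV: the classical data of the quantum part and the box hypotheses

Topic `Algebra/EuclideanLattices` (family `pqc`), sequel of `RegevBoxGaussianState.lean`. The law of
the quantum part (`QPart.law_bound`) is stated over abstract data: a box `Box ⊂ V`, the reduction
`y(x)` and the coset index `s(x)` of every box point, with the fibre hypotheses (`FibreHyps.coset`,
`FibreHyps.yuniq`) and the geometric hypotheses (`‖y(x)‖ ≤ Y`, the box covers the short shifts,
spread `B`). This file supplies Regev's concrete choice on `V = ℝⁿ` and proves those hypotheses: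

* `yOfB bR x = ZSpan.fract bR x` — "`x mod P(Λ)`" for a real basis `bR` of the lattice `Λ` (Regev:
  the LLL-reduced basis, Lemma 3.12, proof: "we compute `x mod P(L)`"; `norm_yOfB_le`: `‖y(x)‖ ≤ Σ‖bRᵢ‖`,
  Regev's "`‖y‖ ≤ diam(P(L))`"), `sub_yOfB_mem`, `yOfB_eq_of_sub_mem` (the `yuniq` field);
* `sOfB bR Λ e R x` — the coordinates of the lattice part `x − y(x)` in the basis `e`, modulo `R`
  (Lemma 3.14, proof: "the natural mapping between `L*/R ∩ P(L*)` and `ℤ_Rⁿ`"), and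
  **`coset_yOfB_sOfB`** (the `coset` field: `x − y(x) ∈ x_{s(x)} + RΛ`);
* the box `boxSet n ℓ D` of `RegevBoxGaussianState`: `mem_boxSet_iff`, `norm_le_of_mem_boxSet`,
  **`boxCoversShort_boxSet`** (when `Λ ⊆ D⁻¹ℤⁿ` and `D(√n + Y) + 1 ≤ 2^{ℓ-1}`, every short lattice
  vector shifted by a reduction lands in the box: Regev's "`ℤⁿ ∩ √n r Bₙ ⊆ {−√n r,…,√n r}ⁿ`"), and
  `norm_sub_yOfB_le` (the spread `B = √n 2^ℓ/D + Y`).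

Everything here is proved; definitions have bodies; no named fact is introduced.

## References

* O. Regev, *On lattices, learning with errors, random linear codes, and cryptography*, J. ACM 56
  (2009), art. 34; arXiv:2401.03703, Lemma 3.12 (proof), Lemma 3.14 (proof) [Regev2009].
-/

noncomputable section

open Module Metric Finset
open scoped Real InnerProductSpace

namespace Literature.Algebra.EuclideanLattices

namespace Regev2009

namespace QPart

open Literature.Computability.QuantumComplexity.GaussianCells

variable {n : ℕ}

/-! ### Coordinates and norms in `ℝⁿ` -/

/-- `‖x‖ ≤ √n · M` when every coordinate is bounded by `M ≥ 0`. [folklore] -/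
theorem norm_le_sqrt_mul (x : EuclideanSpace ℝ (Fin n)) {M : ℝ} (hM : 0 ≤ M) (h : ∀ i, |x i| ≤ M) :
    ‖x‖ ≤ Real.sqrt n * M := by
  have hsq : ‖x‖ ^ 2 ≤ (Real.sqrt n * M) ^ 2 := by
    rw [EuclideanSpace.real_norm_sq_eq, mul_pow, Real.sq_sqrt (Nat.cast_nonneg _)]
    calc ∑ i, x i ^ 2 ≤ ∑ _i : Fin n, M ^ 2 := sum_le_sum fun i _ => sq_le_sq' (abs_le.1 (h i)).1 (abs_le.1 (h i)).2
      _ = n * M ^ 2 := by rw [sum_const, card_univ, Fintype.card_fin, nsmul_eq_mul]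
  exact (pow_le_pow_iff_left₀ (norm_nonneg _) (by positivity) two_ne_zero).1 hsq

/-! ### The box: membership, norms -/

/-- Every value `< 2^ℓ` is a binary value. [folklore] -/
theorem exists_binVal_eq {ℓ : ℕ} {v : ℕ} (hv : v < 2 ^ ℓ) : ∃ y : Fin ℓ → Bool, binVal y = v := by
  classical
  have hsub : (univ : Finset (Fin ℓ → Bool)).image binVal ⊆ Finset.range (2 ^ ℓ) := by
    intro w hw
    obtain ⟨y, -, rfl⟩ := mem_image.1 hw
    exact Finset.mem_range.2 (binVal_lt y)
  have hcard : (Finset.range (2 ^ ℓ)).card ≤ ((univ : Finset (Fin ℓ → Bool)).image binVal).card := by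
    rw [Finset.card_range, Finset.card_image_of_injective _ binVal_injective, card_univ, Fintype.card_fun,
      Fintype.card_bool, Fintype.card_fin]
  have heq := Finset.eq_of_subset_of_card_le hsub hcard
  have hmem : v ∈ (univ : Finset (Fin ℓ → Bool)).image binVal := by rw [heq]; exact Finset.mem_range.2 hv
  obtain ⟨y, -, hy⟩ := mem_image.1 hmem
  exact ⟨y, hy⟩

/-- **Membership in the box**: `x ∈ Box ↔` every coordinate is `k/D` with `−2^{ℓ-1} ≤ k < 2^ℓ − 2^{ℓ-1}`.
[cite: Regev2009, Lemma 3.12 (proof: `{−√n r,…,√n r}ⁿ`)] -/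
theorem mem_boxSet_iff {ℓ : ℕ} {D : ℝ} (x : EuclideanSpace ℝ (Fin n)) :
    x ∈ boxSet n ℓ D ↔ ∀ i, ∃ k : ℤ, -(2 : ℤ) ^ (ℓ - 1) ≤ k ∧ k < 2 ^ ℓ - 2 ^ (ℓ - 1) ∧ x i = (k : ℝ) / D := by
  constructor
  · intro hx i
    obtain ⟨Y, -, rfl⟩ := mem_image.1 hx
    refine ⟨cellPt ℓ (Y i), ?_, ?_, rfl⟩
    · unfold cellPt; have := Nat.cast_nonneg (α := ℤ) (binVal (Y i)); linarith
    · unfold cellPt; have := binVal_lt (Y i); linarith [show ((binVal (Y i) : ℕ) : ℤ) < 2 ^ ℓ by exact_mod_cast this]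
  · intro h
    choose k hk using h
    have hY : ∀ i, ∃ y : Fin ℓ → Bool, cellPt ℓ y = k i := by
      intro i
      obtain ⟨h1, h2, -⟩ := hk i
      have hv : (k i + 2 ^ (ℓ - 1)).toNat < 2 ^ ℓ := by
        have : k i + 2 ^ (ℓ - 1) < 2 ^ ℓ := by linarith
        have h0 : 0 ≤ k i + 2 ^ (ℓ - 1) := by linarith
        zify; rw [Int.toNat_of_nonneg h0]; exact_mod_cast this
      obtain ⟨y, hy⟩ := exists_binVal_eq hv
      refine ⟨y, ?_⟩
      unfold cellPt
      rw [hy, Int.toNat_of_nonneg (by linarith)]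
      ring
    choose Y hYk using hY
    refine mem_image.2 ⟨Y, mem_univ _, ?_⟩
    ext i
    rw [boxPt_apply, hYk, (hk i).2.2]

/-- **Box points are not far**: `‖x‖ ≤ √n · 2^ℓ/D`. [folklore] -/
theorem norm_le_of_mem_boxSet {ℓ : ℕ} {D : ℝ} (hD : 0 < D) {x : EuclideanSpace ℝ (Fin n)} (hx : x ∈ boxSet n ℓ D) :
    ‖x‖ ≤ Real.sqrt n * (2 ^ ℓ / D) := by
  obtain ⟨Y, -, rfl⟩ := mem_image.1 hx
  refine norm_le_sqrt_mul _ (by positivity) fun i => ?_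
  rw [boxPt_apply, abs_div, abs_of_pos hD]
  exact div_le_div_of_nonneg_right (abs_cellPt_le ℓ (Y i)) hD.le

/-! ### The reduction `y(x) = x mod P(Λ)` -/

variable (bR : Basis (Fin n) ℝ (EuclideanSpace ℝ (Fin n)))

/-- **The reduction of `x` modulo the parallelepiped of the basis `bR`** (Mathlib's `ZSpan.fract`).
[cite: Regev2009, Lemma 3.12 (proof: "we compute `x mod P(L)`")] -/
def yOfB (x : EuclideanSpace ℝ (Fin n)) : EuclideanSpace ℝ (Fin n) := ZSpan.fract bR x

/-- **`‖y(x)‖ ≤ Σᵢ ‖bRᵢ‖`** ("`‖y‖ ≤ diam(P(L))`"). [cite: Regev2009, Lemma 3.12 (proof)] -/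
theorem norm_yOfB_le (x : EuclideanSpace ℝ (Fin n)) : ‖yOfB bR x‖ ≤ ∑ i, ‖bR i‖ := ZSpan.norm_fract_le bR x

/-- The lattice part `x − y(x)` lies in the lattice spanned by `bR`. [folklore] -/
theorem sub_yOfB_mem (x : EuclideanSpace ℝ (Fin n)) : x - yOfB bR x ∈ Submodule.span ℤ (Set.range bR) := by
  unfold yOfB
  rw [ZSpan.fract_apply, sub_sub_cancel]
  exact Submodule.coe_mem _

/-- **`y(·)` only depends on the coset**: `x − y(x') ∈ Λ ⇒ y(x) = y(x')`. [cite: Regev2009, Lemma 3.12 (proof)] -/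
theorem yOfB_eq_of_sub_mem {x x' : EuclideanSpace ℝ (Fin n)} (h : x - yOfB bR x' ∈ Submodule.span ℤ (Set.range bR)) :
    yOfB bR x = yOfB bR x' := by
  unfold yOfB at h ⊢
  rw [ZSpan.fract_eq_fract]
  have h' := sub_yOfB_mem bR x'
  unfold yOfB at h'
  have : -x + x' = -((x - ZSpan.fract bR x') - (x' - ZSpan.fract bR x')) := by abel
  rw [this]
  exact Submodule.neg_mem _ (Submodule.sub_mem _ h h')

/-! ### The coset index `s(x)` -/

variable (Λ : Submodule ℤ (EuclideanSpace ℝ (Fin n))) (e : Basis (Fin n) ℤ Λ) (R : ℕ)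

open Classical in
/-- **The coset index of `x`**: the coordinates of the lattice part `x − y(x)` in the basis `e`, modulo `R`
(`0` off the lattice, an unused branch). [cite: Regev2009, Lemma 3.14 (proof: "the natural mapping between `L*/R ∩ P(L*)` and `ℤ_Rⁿ`")] -/
def sOfB (x : EuclideanSpace ℝ (Fin n)) : Fin n → ZMod R := fun i =>
  if h : x - yOfB bR x ∈ Λ then (((e.repr ⟨x - yOfB bR x, h⟩) i : ℤ) : ZMod R) else 0

variable {bR Λ}

/-- **The `coset` field**: `x − y(x) = x_{s(x)} + R z` for some `z ∈ Λ`. [cite: Regev2009, Lemma 3.14 (proof)] -/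
theorem coset_yOfB_sOfB [NeZero R] (hspan : Submodule.span ℤ (Set.range bR) = Λ) (x : EuclideanSpace ℝ (Fin n)) :
    ∃ z : Λ, x - yOfB bR x = reprPt Λ e R (sOfB bR Λ e R x) + (R : ℝ) • (z : EuclideanSpace ℝ (Fin n)) := by
  have hmem : x - yOfB bR x ∈ Λ := by rw [← hspan]; exact sub_yOfB_mem bR x
  set v : Λ := ⟨x - yOfB bR x, hmem⟩ with hv
  set m : Fin n → ℤ := e.equivFun v with hm
  have hsOf : sOfB bR Λ e R x = fun i => ((m i : ℤ) : ZMod R) := by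
    funext i
    unfold sOfB
    rw [dif_pos hmem, hm, Basis.equivFun_apply]
  have hpt : latticePt Λ e m = x - yOfB bR x := by rw [hm, latticePt_equivFun]
  refine ⟨e.equivFun.symm ((euclidEquiv R).symm m).2, ?_⟩
  rw [← hpt, latticePt_eq_reprPt_add Λ e R m, hsOf]
  rfl

/-! ### The box covers the short shifts -/

/-- Casting: an integer of real modulus `< 2^{ℓ-1}` lies in `[−2^{ℓ-1}, 2^{ℓ-1})`. [folklore] -/
theorem int_bounds_of_abs_lt {ℓ : ℕ} {k : ℤ} (h : |(k : ℝ)| < (2 : ℝ) ^ (ℓ - 1)) :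
    -(2 : ℤ) ^ (ℓ - 1) ≤ k ∧ k < 2 ^ (ℓ - 1) := by
  rw [abs_lt] at h
  obtain ⟨h1, h2⟩ := h
  constructor
  · have : (-(2 : ℤ) ^ (ℓ - 1) : ℝ) < k := by push_cast; linarith
    exact_mod_cast this.le
  · exact_mod_cast h2

/-- **The box covers the short shifts of every branch**: if `Λ ⊆ D⁻¹ℤⁿ`, `Σ‖bRᵢ‖ ≤ Y` and
`D(√n + Y) + 1 ≤ 2^{ℓ-1}`, then for every box point `x` and every lattice vector `z` of norm `< √n`,
`z + y(x)` is a box point. [cite: Regev2009, Lemma 3.12 (proof: "`ℤⁿ ∩ √n r Bₙ ⊆ {−√n r,…,√n r}ⁿ`")] -/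
theorem boxCoversShort_boxSet {ℓ : ℕ} {D Y : ℝ} (hD : 0 < D) (hℓ : 1 ≤ ℓ) (hspan : Submodule.span ℤ (Set.range bR) = Λ)
    (hΛD : ∀ v ∈ Λ, ∀ i, ∃ k : ℤ, v i = (k : ℝ) / D) (hY : ∑ i, ‖bR i‖ ≤ Y)
    (hfit : D * (Real.sqrt n + Y) + 1 ≤ (2 : ℝ) ^ (ℓ - 1)) {x : EuclideanSpace ℝ (Fin n)} (hx : x ∈ boxSet n ℓ D) :
    BoxCoversShort Λ (boxSet n ℓ D) (yOfB bR x) := by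
  intro z hz hzn
  rw [finrank_euclideanSpace_fin] at hzn
  rw [mem_boxSet_iff]
  intro i
  -- the coordinate is an integer over `D`
  obtain ⟨k₁, hk₁⟩ := hΛD z hz i
  obtain ⟨k₂, -, -, hk₂⟩ := (mem_boxSet_iff x).1 hx i
  have hlat : x - yOfB bR x ∈ Λ := by rw [← hspan]; exact sub_yOfB_mem bR x
  obtain ⟨k₃, hk₃⟩ := hΛD _ hlat i
  have hk₃' : x i - yOfB bR x i = (k₃ : ℝ) / D := by rw [← PiLp.sub_apply]; exact hk₃
  have hcoord : (z + yOfB bR x) i = ((k₁ + k₂ - k₃ : ℤ) : ℝ) / D := by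
    rw [PiLp.add_apply, hk₁]
    have hy : yOfB bR x i = (k₂ : ℝ) / D - (k₃ : ℝ) / D := by linarith
    rw [hy]
    push_cast
    ring
  refine ⟨k₁ + k₂ - k₃, ?_⟩
  -- the bound
  have hnorm : |(z + yOfB bR x) i| < (2 : ℝ) ^ (ℓ - 1) / D := by
    calc |(z + yOfB bR x) i| ≤ ‖z + yOfB bR x‖ := by simpa [Real.norm_eq_abs] using PiLp.norm_apply_le (z + yOfB bR x) i
      _ ≤ ‖z‖ + ‖yOfB bR x‖ := norm_add_le _ _
      _ < Real.sqrt n + Y := add_lt_add_of_lt_of_le hzn ((norm_yOfB_le bR x).trans hY)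
      _ ≤ ((2 : ℝ) ^ (ℓ - 1) - 1) / D := by rw [le_div_iff₀ hD]; linarith
      _ < (2 : ℝ) ^ (ℓ - 1) / D := div_lt_div_of_pos_right (by linarith) hD
  rw [hcoord, abs_div, abs_of_pos hD, div_lt_div_iff_of_pos_right hD] at hnorm
  obtain ⟨hlo, hhi⟩ := int_bounds_of_abs_lt hnorm
  refine ⟨hlo, ?_, hcoord⟩
  have h2 : (2 : ℤ) ^ ℓ - 2 ^ (ℓ - 1) = 2 ^ (ℓ - 1) := by
    obtain ⟨l, rfl⟩ := Nat.exists_eq_add_of_le hℓ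
    rw [Nat.add_sub_cancel_left]; ring
  rw [h2]; exact hhi

/-- **The spread of the box over a branch**: `‖x − y(x')‖ ≤ √n 2^ℓ/D + Y`. [folklore] -/
theorem norm_sub_yOfB_le {ℓ : ℕ} {D Y : ℝ} (hD : 0 < D) (hY : ∑ i, ‖bR i‖ ≤ Y) {x x' : EuclideanSpace ℝ (Fin n)}
    (hx : x ∈ boxSet n ℓ D) : ‖x - yOfB bR x'‖ ≤ Real.sqrt n * (2 ^ ℓ / D) + Y :=
  (norm_sub_le _ _).trans (add_le_add (norm_le_of_mem_boxSet hD hx) ((norm_yOfB_le bR x').trans hY))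

end QPart

end Regev2009

end Literature.Algebra.EuclideanLattices
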